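import Mathlib
import Summits.CriticalPhenomena.PercolationContinuityZ3.Theorems.PercNearOneGluingNoHeavyLowerTailOrderedDifferencesFramed

/-!
# Union-closed families: 2-chain periodicity and the Marica–Schönheim pencil over every field

Helper file for crux `stmt-CriticalPhenomena-4575` (`NoHeavyLowerTail`, route `PercNearOneGluingNoHeavy`),
new-inequality factory seat `prim-ineq-gen-3` (gen 21).  Everything here is PROVED; no definitions.

Notation as in `…OrderedDifferencesFramed`: `D = 𝒜 \\ 𝒜`, `Z A E = [E ⊆ A]`, `Y A E = [E ∩ A = ∅]`, a RELATION is a pair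
`(λ, μ)` with `λ Z = μ Y` on `D` (memo `run/shared/lean/prim/prim-ineq-gen-3/CONJECTURE-P2.md` §10, Corollary U).

* `eq_zero_of_sum_subsets_eq_zero` — the zeta matrix `[X ⊆ Y]` of a finite set family is invertible (dual of
  `eq_zero_of_sum_supsets_eq_zero`).
* `sum_subsets_eq_sum_covers_of_unionClosed` — for a UNION-CLOSED family with top `T` and a relation `(λ, μ)`:
  `λ(↓A) = ∑_{A' ∪ A = T} μ_{A'}` for every member `A` (reciprocity at the co-member column `T \ A`).  Proof: push `λ, μ` forward along
  `A' ↦ A' ∪ A`; the image family `{D \ A : D ⊇ A}` is FRAMED by `T \ A`, the relation survives (containers and avoiders of its columns are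
  unions of fibres), and THEOREM F (`framed_relation`) applies.
* `twoChain_of_unionClosed` — union-closed families have the 2-chain periodicity property P2: `λZ = μY`, `μZ = νY` ⟹ `λ = ν`
  [`λ(↓A) = μ(Co A) = ν(↓A)`, then Möbius inversion on `(𝒜, ⊆)`].
* `linearIndependent_pencil_of_unionClosed` — hence the pencil rows `A ↦ (E ↦ [E ⊆ A] + t [E ∩ A = ∅])` over `𝒜 \\ 𝒜` are linearly
  independent over EVERY field for every `t` with `t * t ≠ 1`, for every union-closed family (by complementation `A ↦ T \ A`, which swaps
  `Z` and `Y` over the same `D`, the same holds for intersection-closed families — not spelled out here).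
(prim-ineq-gen-3 gen 21, 2026-08-23.)
-/

namespace Summit.CriticalPhenomena.PercolationContinuityZ3.Theorems

namespace OrderedDifferences

open Finset
open scoped FinsetFamily

variable {α : Type*} [DecidableEq α] {K : Type*} [Field K]

/-- Dual of `eq_zero_of_sum_supsets_eq_zero`: if `∑_{X ∈ ℬ, X ⊆ Y} κ X = 0` for every `Y ∈ ℬ` then `κ` vanishes on `ℬ`. -/
theorem eq_zero_of_sum_subsets_eq_zero (ℬ : Finset (Finset α)) (κ : Finset α → K)
    (h : ∀ Y ∈ ℬ, ∑ X ∈ ℬ.filter (fun X => X ⊆ Y), κ X = 0) : ∀ X ∈ ℬ, κ X = 0 := by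
  classical
  let S : Finset (Finset α) := ℬ.filter (fun X => κ X ≠ 0)
  rcases S.eq_empty_or_nonempty with hS | hS
  · intro X hX
    by_contra hκ
    have : X ∈ S := mem_filter.mpr ⟨hX, hκ⟩
    rw [hS] at this
    exact absurd this (Finset.notMem_empty X)
  exfalso
  obtain ⟨Y, hYS, hYmin⟩ := exists_min_image S card hS
  have hYℬ : Y ∈ ℬ := (mem_filter.mp hYS).1
  have hκY : κ Y ≠ 0 := (mem_filter.mp hYS).2
  have hzero : ∀ X ∈ ℬ.filter (fun X => X ⊆ Y), X ≠ Y → κ X = 0 := by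
    intro X hX hXY
    obtain ⟨hXℬ, hXY'⟩ := mem_filter.mp hX
    by_contra hκX
    have hXS : X ∈ S := mem_filter.mpr ⟨hXℬ, hκX⟩
    have hcard : #Y ≤ #X := hYmin X hXS
    exact hXY (eq_of_subset_of_card_le hXY' hcard)
  have hsum := h Y hYℬ
  have hYmem : Y ∈ ℬ.filter (fun X => X ⊆ Y) := mem_filter.mpr ⟨hYℬ, subset_rfl⟩
  rw [← add_sum_erase _ _ hYmem] at hsum
  have hrest : ∑ X ∈ (ℬ.filter (fun X => X ⊆ Y)).erase Y, κ X = 0 :=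
    sum_eq_zero fun X hX => hzero X (mem_of_mem_erase hX) (ne_of_mem_erase hX)
  rw [hrest, add_zero] at hsum
  exact hκY hsum

/-- **Union-closed families: reciprocity at the co-member columns.**  Let `𝒜` be closed under pairwise unions, `T ∈ 𝒜` with every
member inside `T`, and let `λ Z = μ Y` on `𝒜 \\ 𝒜`.  Then for every member `A`:  `∑_{A' ⊆ A} λ_{A'} = ∑_{A' ∪ A = T} μ_{A'}`.
[Push `λ, μ` forward along `A' ↦ A' ∪ A`; the image family `{D \ A : D ∈ 𝒜, D ⊇ A}` is framed by `T \ A`, and the relation survives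
because containment and avoidance of its columns are saturated for the fibres; then apply `framed_relation`.] -/
theorem sum_subsets_eq_sum_covers_of_unionClosed (𝒜 : Finset (Finset α)) (T : Finset α)
    (hU : ∀ A ∈ 𝒜, ∀ B ∈ 𝒜, A ∪ B ∈ 𝒜) (hT : T ∈ 𝒜) (hsub : ∀ A ∈ 𝒜, A ⊆ T) (l m : ↥𝒜 → K)
    (h1 : ∀ E ∈ 𝒜 \\ 𝒜, ∑ A : 𝒜, l A * (if E ⊆ (A : Finset α) then (1 : K) else 0) =
        ∑ A : 𝒜, m A * (if Disjoint E (A : Finset α) then (1 : K) else 0))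
    (A₀ : Finset α) (hA₀ : A₀ ∈ 𝒜) :
    ∑ A : 𝒜, l A * (if (A : Finset α) ⊆ A₀ then (1 : K) else 0) =
      ∑ A : 𝒜, m A * (if (A : Finset α) ∪ A₀ = T then (1 : K) else 0) := by
  classical
  -- the pushed-forward family and measures
  let π : Finset α → Finset α := fun A => (A ∪ A₀) \ A₀
  let 𝒜' : Finset (Finset α) := 𝒜.image π
  let lv : Finset α → K := fun X => if hX : X ∈ 𝒜 then l ⟨X, hX⟩ else 0
  let mv : Finset α → K := fun X => if hX : X ∈ 𝒜 then m ⟨X, hX⟩ else 0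
  have hlv : ∀ A : 𝒜, lv A = l A := fun A => by simp only [lv, dif_pos A.2]
  have hmv : ∀ A : 𝒜, mv A = m A := fun A => by simp only [mv, dif_pos A.2]
  let l' : ↥𝒜' → K := fun X => ∑ A ∈ 𝒜.filter (fun A => π A = X), lv A
  let m' : ↥𝒜' → K := fun X => ∑ A ∈ 𝒜.filter (fun A => π A = X), mv A
  have hmaps : ∀ A ∈ 𝒜, π A ∈ 𝒜' := fun A hA => mem_image_of_mem π hA
  -- `𝒜'` is framed by `T \ A₀`
  have h0' : (∅ : Finset α) ∈ 𝒜' := by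
    refine mem_image.mpr ⟨A₀, hA₀, ?_⟩
    show (A₀ ∪ A₀) \ A₀ = ∅
    rw [union_idempotent, sdiff_self]; rfl
  have hT' : T \ A₀ ∈ 𝒜' := by
    refine mem_image.mpr ⟨T, hT, ?_⟩
    show (T ∪ A₀) \ A₀ = T \ A₀
    rw [union_eq_left.mpr (hsub A₀ hA₀)]
  have hsub' : ∀ X ∈ 𝒜', X ⊆ T \ A₀ := by
    intro X hX
    obtain ⟨A, hA, rfl⟩ := mem_image.mp hX
    exact sdiff_subset_sdiff (union_subset (hsub A hA) (hsub A₀ hA₀)) subset_rfl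
  -- a general fibrewise rewriting of sums over `𝒜'`
  have fib : ∀ (w : Finset α → K) (g : Finset α → K),
      ∑ X : 𝒜', (∑ A ∈ 𝒜.filter (fun A => π A = X), w A) * g X = ∑ A ∈ 𝒜, w A * g (π A) := by
    intro w g
    have e1 : ∑ X : 𝒜', (∑ A ∈ 𝒜.filter (fun A => π A = X), w A) * g X =
        ∑ X ∈ 𝒜', (∑ A ∈ 𝒜.filter (fun A => π A = X), w A) * g X :=
      Finset.sum_coe_sort 𝒜' (fun X => (∑ A ∈ 𝒜.filter (fun A => π A = X), w A) * g X)
    rw [e1]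
    have e2 : ∀ X ∈ 𝒜', (∑ A ∈ 𝒜.filter (fun A => π A = X), w A) * g X =
        ∑ A ∈ 𝒜.filter (fun A => π A = X), w A * g (π A) := by
      intro X hX
      rw [sum_mul]
      refine sum_congr rfl fun A hA => ?_
      rw [(mem_filter.mp hA).2]
    rw [sum_congr rfl e2]
    exact sum_fiberwise_of_maps_to hmaps (fun A => w A * g (π A))
  -- the columns of `𝒜' \\ 𝒜'` are columns of `𝒜 \\ 𝒜` disjoint from `A₀`
  have hcol : ∀ E ∈ 𝒜' \\ 𝒜', E ∈ 𝒜 \\ 𝒜 ∧ Disjoint E A₀ := by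
    intro E hE
    obtain ⟨X₁, hX₁, X₂, hX₂, rfl⟩ := mem_diffs.mp hE
    obtain ⟨A₁, hA₁, rfl⟩ := mem_image.mp hX₁
    obtain ⟨A₂, hA₂, rfl⟩ := mem_image.mp hX₂
    have e : π A₁ \ π A₂ = (A₁ ∪ A₀) \ (A₂ ∪ A₀) := by
      show ((A₁ ∪ A₀) \ A₀) \ ((A₂ ∪ A₀) \ A₀) = (A₁ ∪ A₀) \ (A₂ ∪ A₀)
      ext x
      simp only [mem_sdiff, mem_union]
      tauto
    refine ⟨mem_diffs.mpr ⟨A₁ ∪ A₀, hU A₁ hA₁ A₀ hA₀, A₂ ∪ A₀, hU A₂ hA₂ A₀ hA₀, e.symm⟩, ?_⟩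
    rw [Finset.disjoint_left]
    intro x hx hx0
    have hx' := (mem_sdiff.mp (mem_sdiff.mp hx).1).2
    exact hx' hx0
  -- the relation for the pushed-forward measures
  have h1' : ∀ E ∈ 𝒜' \\ 𝒜', ∑ X : 𝒜', l' X * (if E ⊆ (X : Finset α) then (1 : K) else 0) =
      ∑ X : 𝒜', m' X * (if Disjoint E (X : Finset α) then (1 : K) else 0) := by
    intro E hE
    obtain ⟨hED, hEA₀⟩ := hcol E hE
    have eL : ∑ X : 𝒜', l' X * (if E ⊆ (X : Finset α) then (1 : K) else 0) =
        ∑ A : 𝒜, l A * (if E ⊆ (A : Finset α) then (1 : K) else 0) := by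
      have := fib lv (fun X => if E ⊆ X then (1 : K) else 0)
      rw [this, ← Finset.sum_coe_sort 𝒜]
      refine sum_congr rfl fun A _ => ?_
      rw [hlv A]
      have hiff : E ⊆ π A ↔ E ⊆ (A : Finset α) := by
        show E ⊆ ((A : Finset α) ∪ A₀) \ A₀ ↔ E ⊆ (A : Finset α)
        rw [subset_sdiff]
        constructor
        · rintro ⟨h, hd⟩
          intro x hx
          rcases mem_union.mp (h hx) with h1 | h2
          · exact h1
          · exact absurd h2 (Finset.disjoint_left.mp hd hx)
        · intro h
          exact ⟨h.trans subset_union_left, hEA₀⟩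
      simp only [hiff]
    have eM : ∑ X : 𝒜', m' X * (if Disjoint E (X : Finset α) then (1 : K) else 0) =
        ∑ A : 𝒜, m A * (if Disjoint E (A : Finset α) then (1 : K) else 0) := by
      have := fib mv (fun X => if Disjoint E X then (1 : K) else 0)
      rw [this, ← Finset.sum_coe_sort 𝒜]
      refine sum_congr rfl fun A _ => ?_
      rw [hmv A]
      have hiff : Disjoint E (π A) ↔ Disjoint E (A : Finset α) := by
        show Disjoint E (((A : Finset α) ∪ A₀) \ A₀) ↔ Disjoint E (A : Finset α)
        rw [Finset.disjoint_left, Finset.disjoint_left]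
        constructor
        · intro h x hxE hxA
          exact h hxE (mem_sdiff.mpr ⟨mem_union_left _ hxA, Finset.disjoint_left.mp hEA₀ hxE⟩)
        · intro h x hxE hx
          rcases mem_union.mp (mem_sdiff.mp hx).1 with h1 | h2
          · exact h hxE h1
          · exact (mem_sdiff.mp hx).2 h2
      simp only [hiff]
    rw [eL, eM]
    exact h1 E hED
  -- apply THEOREM F to the framed family `𝒜'` with the complementary members `∅` and `T \ A₀`
  obtain ⟨-, hcpl⟩ := framed_relation 𝒜' (T \ A₀) h0' hT' hsub' l' m' h1'
  have key := hcpl ⟨T \ A₀, hT'⟩ ⟨∅, h0'⟩ (by show (∅ : Finset α) = (T \ A₀) \ (T \ A₀); rw [sdiff_self]; rfl)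
  -- unfold both sides
  have eR : l' ⟨∅, h0'⟩ = ∑ A : 𝒜, l A * (if (A : Finset α) ⊆ A₀ then (1 : K) else 0) := by
    show ∑ A ∈ 𝒜.filter (fun A => π A = ∅), lv A = _
    rw [sum_filter, ← Finset.sum_coe_sort 𝒜]
    refine sum_congr rfl fun A _ => ?_
    have hiff : π A = ∅ ↔ (A : Finset α) ⊆ A₀ := by
      show ((A : Finset α) ∪ A₀) \ A₀ = ∅ ↔ (A : Finset α) ⊆ A₀
      rw [sdiff_eq_empty_iff_subset, union_subset_iff]
      exact ⟨fun h => h.1, fun h => ⟨h, subset_rfl⟩⟩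
    rw [hlv A]
    by_cases h : (A : Finset α) ⊆ A₀
    · rw [if_pos (hiff.mpr h), if_pos h, mul_one]
    · rw [if_neg (fun h' => h (hiff.mp h')), if_neg h, mul_zero]
  have eL : m' ⟨T \ A₀, hT'⟩ = ∑ A : 𝒜, m A * (if (A : Finset α) ∪ A₀ = T then (1 : K) else 0) := by
    show ∑ A ∈ 𝒜.filter (fun A => π A = T \ A₀), mv A = _
    rw [sum_filter, ← Finset.sum_coe_sort 𝒜]
    refine sum_congr rfl fun A _ => ?_
    have hAT : (A : Finset α) ∪ A₀ ⊆ T := union_subset (hsub A A.2) (hsub A₀ hA₀)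
    have hiff : π A = T \ A₀ ↔ (A : Finset α) ∪ A₀ = T := by
      show ((A : Finset α) ∪ A₀) \ A₀ = T \ A₀ ↔ (A : Finset α) ∪ A₀ = T
      constructor
      · intro h
        apply Subset.antisymm hAT
        intro x hx
        by_cases hx0 : x ∈ A₀
        · exact mem_union_right _ hx0
        · have : x ∈ ((A : Finset α) ∪ A₀) \ A₀ := by rw [h]; exact mem_sdiff.mpr ⟨hx, hx0⟩
          exact (mem_sdiff.mp this).1
      · intro h
        rw [h]
    rw [hmv A]
    by_cases h : (A : Finset α) ∪ A₀ = T
    · rw [if_pos (hiff.mpr h), if_pos h, mul_one]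
    · rw [if_neg (fun h' => h (hiff.mp h')), if_neg h, mul_zero]
  rw [← eR, ← eL]
  exact key.symm

/-- **2-chain periodicity for union-closed families.**  If `𝒜` is closed under pairwise unions, then `λZ = μY` and `μZ = νY` on
`𝒜 \\ 𝒜` force `λ = ν`.  [By `sum_subsets_eq_sum_covers_of_unionClosed` and the relations at the columns `T \ A`,
`λ(↓A) = μ(Co A) = ν(↓A)` for every member `A`; Möbius inversion on `(𝒜, ⊆)`.] -/
theorem twoChain_of_unionClosed (𝒜 : Finset (Finset α)) (hU : ∀ A ∈ 𝒜, ∀ B ∈ 𝒜, A ∪ B ∈ 𝒜) (l m n : ↥𝒜 → K)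
    (h1 : ∀ E ∈ 𝒜 \\ 𝒜, ∑ A : 𝒜, l A * (if E ⊆ (A : Finset α) then (1 : K) else 0) =
        ∑ A : 𝒜, m A * (if Disjoint E (A : Finset α) then (1 : K) else 0))
    (h2 : ∀ E ∈ 𝒜 \\ 𝒜, ∑ A : 𝒜, m A * (if E ⊆ (A : Finset α) then (1 : K) else 0) =
        ∑ A : 𝒜, n A * (if Disjoint E (A : Finset α) then (1 : K) else 0)) : l = n := by
  classical
  rcases 𝒜.eq_empty_or_nonempty with h𝒜 | h𝒜
  · funext A
    exact (Finset.nonempty_iff_ne_empty.mp ⟨(A : Finset α), A.2⟩ h𝒜).elim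
  -- the top member
  let T : Finset α := 𝒜.sup id
  have hsub : ∀ A ∈ 𝒜, A ⊆ T := fun A hA => Finset.le_sup (f := id) hA
  have hT : T ∈ 𝒜 := by
    -- the sup of a nonempty union-closed family belongs to it
    have : ∀ (s : Finset (Finset α)), s.Nonempty → s ⊆ 𝒜 → s.sup id ∈ 𝒜 := by
      intro s
      induction s using Finset.induction_on with
      | empty => intro h; exact absurd h Finset.not_nonempty_empty
      | @insert X s hX ih =>
        intro _ hs
        rw [sup_insert, id]
        rcases s.eq_empty_or_nonempty with hs0 | hs0
        · rw [hs0, sup_empty, bot_eq_empty, sup_eq_union, union_empty]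
          exact hs (mem_insert_self X s)
        · exact hU X (hs (mem_insert_self X s)) _ (ih hs0 (fun Y hY => hs (mem_insert_of_mem hY)))
    exact this 𝒜 h𝒜 subset_rfl
  -- `λ(↓A) = ν(↓A)` for every member `A`
  have hdown : ∀ A₀ ∈ 𝒜, ∑ A : 𝒜, (l A - n A) * (if (A : Finset α) ⊆ A₀ then (1 : K) else 0) = 0 := by
    intro A₀ hA₀
    have e1 := sum_subsets_eq_sum_covers_of_unionClosed 𝒜 T hU hT hsub l m h1 A₀ hA₀
    -- relation `(μ, ν)` at the column `T \ A₀`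
    have hcolT : T \ A₀ ∈ 𝒜 \\ 𝒜 := mem_diffs.mpr ⟨T, hT, A₀, hA₀, rfl⟩
    have e2 := h2 (T \ A₀) hcolT
    have e2' : ∑ A : 𝒜, m A * (if (A : Finset α) ∪ A₀ = T then (1 : K) else 0) =
        ∑ A : 𝒜, n A * (if (A : Finset α) ⊆ A₀ then (1 : K) else 0) := by
      have eU : ∀ A : 𝒜, (T \ A₀ ⊆ (A : Finset α)) ↔ ((A : Finset α) ∪ A₀ = T) := by
        intro A
        constructor
        · intro h
          apply Subset.antisymm (union_subset (hsub A A.2) (hsub A₀ hA₀))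
          intro x hx
          by_cases hx0 : x ∈ A₀
          · exact mem_union_right _ hx0
          · exact mem_union_left _ (h (mem_sdiff.mpr ⟨hx, hx0⟩))
        · intro h x hx
          have hxT := (mem_sdiff.mp hx).1
          rw [← h] at hxT
          rcases mem_union.mp hxT with h1 | h2
          · exact h1
          · exact absurd h2 (mem_sdiff.mp hx).2
      have eD : ∀ A : 𝒜, Disjoint (T \ A₀) (A : Finset α) ↔ (A : Finset α) ⊆ A₀ := by
        intro A
        rw [Finset.disjoint_left]
        constructor
        · intro h x hx
          by_contra hx0
          exact h (mem_sdiff.mpr ⟨hsub A A.2 hx, hx0⟩) hx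
        · intro h x hx hxA
          exact (mem_sdiff.mp hx).2 (h hxA)
      have eLHS : ∑ A : 𝒜, m A * (if T \ A₀ ⊆ (A : Finset α) then (1 : K) else 0) =
          ∑ A : 𝒜, m A * (if (A : Finset α) ∪ A₀ = T then (1 : K) else 0) :=
        sum_congr rfl fun A _ => by simp only [eU A]
      have eRHS : ∑ A : 𝒜, n A * (if Disjoint (T \ A₀) (A : Finset α) then (1 : K) else 0) =
          ∑ A : 𝒜, n A * (if (A : Finset α) ⊆ A₀ then (1 : K) else 0) :=
        sum_congr rfl fun A _ => by simp only [eD A]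
      rw [← eLHS, ← eRHS]
      exact e2
    have e3 : ∑ A : 𝒜, (l A - n A) * (if (A : Finset α) ⊆ A₀ then (1 : K) else 0) =
        ∑ A : 𝒜, l A * (if (A : Finset α) ⊆ A₀ then (1 : K) else 0) -
          ∑ A : 𝒜, n A * (if (A : Finset α) ⊆ A₀ then (1 : K) else 0) := by
      rw [← sum_sub_distrib]; refine sum_congr rfl fun A _ => ?_; ring
    rw [e3, e1, e2', sub_self]
  -- Möbius inversion on `(𝒜, ⊆)`
  let κ : Finset α → K := fun X => if hX : X ∈ 𝒜 then l ⟨X, hX⟩ - n ⟨X, hX⟩ else 0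
  have hκ : ∀ Y ∈ 𝒜, ∑ X ∈ 𝒜.filter (fun X => X ⊆ Y), κ X = 0 := by
    intro Y hY
    have e : ∑ X ∈ 𝒜.filter (fun X => X ⊆ Y), κ X =
        ∑ A : 𝒜, (l A - n A) * (if (A : Finset α) ⊆ Y then (1 : K) else 0) := by
      rw [sum_filter, ← Finset.sum_coe_sort 𝒜]
      refine sum_congr rfl fun A _ => ?_
      simp only [κ, dif_pos A.2]
      split_ifs <;> simp
    rw [e]
    exact hdown Y hY
  have h0 := eq_zero_of_sum_subsets_eq_zero 𝒜 κ hκ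
  funext A
  have := h0 A A.2
  simp only [κ, dif_pos A.2] at this
  exact sub_eq_zero.mp this

/-- **The Marica–Schönheim pencil theorem over every field for union-closed families.**  If `𝒜` is closed under pairwise unions,
then for every field `K` and every `t ∈ K` with `t * t ≠ 1` the pencil rows `A ↦ (E ↦ [E ⊆ A] + t [E ∩ A = ∅])` over `𝒜 \\ 𝒜` are
linearly independent over `K`.  (A dependency `c` is the 2-chain `c → -t c → t² c`; `twoChain_of_unionClosed`.) -/
theorem linearIndependent_pencil_of_unionClosed (𝒜 : Finset (Finset α)) (hU : ∀ A ∈ 𝒜, ∀ B ∈ 𝒜, A ∪ B ∈ 𝒜)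
    {t : K} (ht : t * t ≠ 1) :
    LinearIndependent K (fun A : 𝒜 => fun E : (𝒜 \\ 𝒜 : Finset (Finset α)) =>
      (if (E : Finset α) ⊆ (A : Finset α) then (1 : K) else 0) +
        t * (if Disjoint (E : Finset α) (A : Finset α) then (1 : K) else 0)) := by
  classical
  rw [Fintype.linearIndependent_iff]
  intro c hc
  have hdep : ∀ E ∈ 𝒜 \\ 𝒜, ∑ A : 𝒜, c A * (if E ⊆ (A : Finset α) then (1 : K) else 0) +
      t * ∑ A : 𝒜, c A * (if Disjoint E (A : Finset α) then (1 : K) else 0) = 0 := by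
    intro E hE
    have h := congr_fun hc ⟨E, hE⟩
    simp only [Finset.sum_apply, Pi.smul_apply, smul_eq_mul, Pi.zero_apply] at h
    have e : ∑ A : 𝒜, c A * (if E ⊆ (A : Finset α) then (1 : K) else 0) +
        t * ∑ A : 𝒜, c A * (if Disjoint E (A : Finset α) then (1 : K) else 0) =
        ∑ A : 𝒜, c A * ((if E ⊆ (A : Finset α) then (1 : K) else 0) +
          t * (if Disjoint E (A : Finset α) then (1 : K) else 0)) := by
      rw [mul_sum, ← sum_add_distrib]
      refine sum_congr rfl fun A _ => ?_
      ring
    rw [e]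
    exact h
  have h1 : ∀ E ∈ 𝒜 \\ 𝒜, ∑ A : 𝒜, c A * (if E ⊆ (A : Finset α) then (1 : K) else 0) =
      ∑ A : 𝒜, (-t * c A) * (if Disjoint E (A : Finset α) then (1 : K) else 0) := by
    intro E hE
    have h := hdep E hE
    have e2 : ∑ A : 𝒜, (-t * c A) * (if Disjoint E (A : Finset α) then (1 : K) else 0) =
        -t * ∑ A : 𝒜, c A * (if Disjoint E (A : Finset α) then (1 : K) else 0) := by
      rw [mul_sum]; refine sum_congr rfl fun A _ => ?_; ring
    rw [e2]; linear_combination h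
  have h2 : ∀ E ∈ 𝒜 \\ 𝒜, ∑ A : 𝒜, (-t * c A) * (if E ⊆ (A : Finset α) then (1 : K) else 0) =
      ∑ A : 𝒜, (t * t * c A) * (if Disjoint E (A : Finset α) then (1 : K) else 0) := by
    intro E hE
    have h := h1 E hE
    have e1 : ∑ A : 𝒜, (-t * c A) * (if E ⊆ (A : Finset α) then (1 : K) else 0) =
        -t * ∑ A : 𝒜, c A * (if E ⊆ (A : Finset α) then (1 : K) else 0) := by
      rw [mul_sum]; refine sum_congr rfl fun A _ => ?_; ring
    have e2 : ∑ A : 𝒜, (t * t * c A) * (if Disjoint E (A : Finset α) then (1 : K) else 0) =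
        -t * ∑ A : 𝒜, (-t * c A) * (if Disjoint E (A : Finset α) then (1 : K) else 0) := by
      rw [mul_sum]; refine sum_congr rfl fun A _ => ?_; ring
    rw [e1, e2, h]
  have hcn := twoChain_of_unionClosed 𝒜 hU c (fun A => -t * c A) (fun A => t * t * c A) h1 h2
  intro A
  have hA := congr_fun hcn A
  have h3 : (1 - t * t) * c A = 0 := by linear_combination hA
  rcases mul_eq_zero.mp h3 with h4 | h4
  · exact absurd (by linear_combination -h4) ht
  · exact h4

end OrderedDifferences

end Summit.CriticalPhenomena.PercolationContinuityZ3.Theorems
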